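import Summits.ValiantsHypothesis.ValiantsHypothesis.Theorems.TwoAdicLadderOddPermanentLift
import Literature.Computability.AlgebraicComplexity.HighestWeightPairingCertificates

/-!
# TwoAdicLadder, support item `CeilingModFour` (stmt-ValiantsHypothesis-5949) — PROVED

Route `TwoAdicLadder` of `ValiantsHypothesis`, support item `CeilingModFour`: **the permanent is
p-computable by division-free circuits over `ℤ/4`** — unconditionally ("algebraic Valiant at
`k = 2`").

Proof. Over any commutative ring `per_n − det_n = 2 Q̄_n` with `Q̄_n = Σ_{sign σ = −1} x^σ`
(`perPoly_sub_detPoly_eq`, item `OddPermanentLift`). Modulo `2`, `Q̄_n ≡ Σ_σ inv(σ) · x^σ`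
(the sign is `(−1)^{inversions}`, tree `PairingDP.sign_eq_neg_one_pow`), and counting inversions by
the inverted pair of columns `a < b` (rows `σ b = i < i' = σ a`),
`Σ_σ inv(σ) x^σ = Σ_{a<b, i<i'} det N^{ab}_{ii'}` over `𝔽₂`, where `N^{ab}_{ii'}` is the generic matrix
with column `a` *pinned* to its entry in row `i'` and column `b` pinned to its entry in row `i`
(all other entries of these two columns set to `0`): by Leibniz, `det N^{ab}_{ii'}` is the signed sum
of the monomials `x^σ` with `σ a = i'`, `σ b = i`. Each `det N^{ab}_{ii'}` is a substitution instance
of `det_n` (variables ↦ variables or `0`), so `L(det N^{ab}_{ii'}) ≤ L(det_n)` over every ring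
(Bürgisser's substitution bound `complexity_aeval_le`). Lifting to `ℤ/4`: the same sum `J_n` over
`ℤ/4` reduces mod `2` to `Q̄_n mod 2`, hence `2 J_n = 2 Q̄_n = per_n − det_n` in `(ℤ/4)[x]`
(`two_smul_eq_zero_of_map_castHom_eq_zero`), i.e. **`per_n = det_n + 2 J_n` over `ℤ/4`**, and
`L(per_n) ≤ L(det_n) + n⁴ (L(det_n) + 1) + 3` is polynomially bounded by Berkowitz
(`isVPFamily_detPoly_of_commRing`). This is the `k = 1` truncation of the expansion
`per = Σ_k (−2)^k J_k` behind Valiant's `per mod 2^k` algorithm [Valiant 1979, §4], done symbolically.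
Honest framing: a calibration fact inside a dormant route (nothing modulo `4` separates `per` from
`det`); it does not bear on VP ≠ VNP.
-/

noncomputable section

open MvPolynomial

-- the summit and the problem share the name `ValiantsHypothesis` (D-0017 single-conjunct layout)
set_option linter.dupNamespace false

namespace Summit.ValiantsHypothesis.ValiantsHypothesis.Theorems.TwoAdicLadder

open Literature.Computability.AlgebraicComplexity

variable {R : Type*} [CommRing R] {n : ℕ}

/-- Leibniz expansion of the pinned generic matrix `N^{ab}_{ii'}` (column `a` pinned to row `i'`,
column `b` pinned to row `i`): the signed sum of the monomials `x^σ` with `σ a = i'`, `σ b = i`. -/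
theorem det_pinned_eq (a b i i' : Fin n) :
    (Matrix.of fun r c : Fin n =>
        if (c = a → r = i') ∧ (c = b → r = i) then (X (r, c) : MvPolynomial (Fin n × Fin n) R)
        else 0).det =
      ∑ σ : Equiv.Perm (Fin n), if σ a = i' ∧ σ b = i then
        Equiv.Perm.sign σ • ∏ c, (X (σ c, c) : MvPolynomial (Fin n × Fin n) R) else 0 := by
  rw [Matrix.det_apply]
  refine Finset.sum_congr rfl fun σ _ => ?_
  simp only [Matrix.of_apply]
  rw [Fintype.prod_ite_zero]
  have hiff : (∀ c : Fin n, (c = a → σ c = i') ∧ (c = b → σ c = i)) ↔ (σ a = i' ∧ σ b = i) := by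
    constructor
    · intro h
      exact ⟨(h a).1 rfl, (h b).2 rfl⟩
    · rintro ⟨ha, hb⟩ c
      exact ⟨fun hc => by rw [hc]; exact ha, fun hc => by rw [hc]; exact hb⟩
  by_cases h : σ a = i' ∧ σ b = i
  · rw [if_pos (hiff.2 h), if_pos h]
  · rw [if_neg (fun h' => h (hiff.1 h')), if_neg h, smul_zero]

/-- The pinned determinant is the substitution instance of `det_n` under
`x_{rc} ↦ x_{rc}` or `0`. -/
theorem det_pinned_eq_aeval (a b i i' : Fin n) :
    (Matrix.of fun r c : Fin n =>
        if (c = a → r = i') ∧ (c = b → r = i) then (X (r, c) : MvPolynomial (Fin n × Fin n) R)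
        else 0).det =
      aeval (fun v : Fin n × Fin n =>
        if (v.2 = a → v.1 = i') ∧ (v.2 = b → v.1 = i) then
          (X v : MvPolynomial (Fin n × Fin n) R) else 0) (detPoly (Fin n) R) := by
  rw [detPoly, AlgHom.map_det]
  congr 1
  ext r c
  simp only [Matrix.of_apply, AlgHom.mapMatrix_apply, Matrix.map_apply,
    Matrix.mvPolynomialX_apply, aeval_X]

/-- `L(det N^{ab}_{ii'}) ≤ L(det_n)` (substitution of variables and zeros is free). -/
theorem complexity_det_pinned_le (a b i i' : Fin n) :
    complexity (Matrix.of fun r c : Fin n =>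
        if (c = a → r = i') ∧ (c = b → r = i) then (X (r, c) : MvPolynomial (Fin n × Fin n) R)
        else 0).det ≤ complexity (detPoly (Fin n) R) := by
  rw [det_pinned_eq_aeval]
  refine (complexity_aeval_le _ _).trans ?_
  have h0 : ∀ v : Fin n × Fin n, complexity (if (v.2 = a → v.1 = i') ∧ (v.2 = b → v.1 = i) then
      (X v : MvPolynomial (Fin n × Fin n) R) else 0) = 0 := by
    intro v
    split_ifs
    · exact complexity_X_holds v
    · rw [← C_0]
      exact complexity_C_holds 0
  simp only [h0, Finset.sum_const_zero, add_zero, le_refl]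

/-- The parity of the inversion count is the sign: `inv(σ) ≡ [sign σ = −1] (mod 2)`. -/
theorem invCountP_cast_zmod_two (σ : Equiv.Perm (Fin n)) :
    ((PairingDP.invCountP σ : ℕ) : ZMod 2) = if Equiv.Perm.sign σ = -1 then 1 else 0 := by
  have h := PairingDP.sign_eq_neg_one_pow σ
  by_cases hs : Equiv.Perm.sign σ = -1
  · rw [if_pos hs, ZMod.natCast_eq_one_iff_odd]
    rw [hs] at h
    rcases Nat.even_or_odd (PairingDP.invCountP σ) with he | ho
    · exfalso
      rw [he.neg_one_pow] at h
      norm_num at h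
    · exact ho
  · rw [if_neg hs, ZMod.natCast_eq_zero_iff_even]
    rw [(Int.units_eq_one_or _).resolve_right hs] at h
    rcases Nat.even_or_odd (PairingDP.invCountP σ) with he | ho
    · exact he
    · exfalso
      rw [ho.neg_one_pow] at h
      norm_num at h

/-- Counting the solutions of the pinning constraints: for fixed columns `a, b` and a permutation
`σ`, `Σ_{i,i'} [a < b ∧ i < i'] [σ a = i' ∧ σ b = i] = [a < b ∧ σ b < σ a]`. -/
theorem sum_sum_ite_pin_eq (σ : Equiv.Perm (Fin n)) (a b : Fin n) :
    (∑ i : Fin n, ∑ i' : Fin n,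
      if (a < b ∧ i < i') ∧ (σ a = i' ∧ σ b = i) then (1 : ZMod 2) else 0) =
      if a < b ∧ σ b < σ a then 1 else 0 := by
  rw [Finset.sum_eq_single (σ b)]
  · rw [Finset.sum_eq_single (σ a)]
    · by_cases hab : a < b <;> by_cases hlt : σ b < σ a <;> simp [hab, hlt]
    · intro i' _ hi'
      rw [if_neg]
      rintro ⟨-, h, -⟩
      exact hi' h.symm
    · simp
  · intro i _ hi
    refine Finset.sum_eq_zero fun i' _ => ?_
    rw [if_neg]
    rintro ⟨-, -, h⟩
    exact hi h.symm
  · simp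

/-- **The mod-2 core identity**: over `𝔽₂`, the sum of the pinned determinants over `a < b`, `i < i'`
is the odd-permutation polynomial `Q̄_n = Σ_{sign σ = −1} x^σ` (count inversions by the inverted pair;
`inv(σ) ≡ [σ odd]`). -/
theorem sum_det_pinned_eq_oddPerm (n : ℕ) :
    (∑ q : Fin n × Fin n × Fin n × Fin n,
      if q.1 < q.2.1 ∧ q.2.2.1 < q.2.2.2 then
        (Matrix.of fun r c : Fin n =>
          if (c = q.1 → r = q.2.2.2) ∧ (c = q.2.1 → r = q.2.2.1) then
            (X (r, c) : MvPolynomial (Fin n × Fin n) (ZMod 2)) else 0).det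
      else 0) =
    ∑ σ ∈ (Finset.univ : Finset (Equiv.Perm (Fin n))).filter (fun σ => Equiv.Perm.sign σ = -1),
      ∏ c : Fin n, (X (σ c, c) : MvPolynomial (Fin n × Fin n) (ZMod 2)) := by
  classical
  -- signless Leibniz in characteristic 2
  have hsmul : ∀ (σ : Equiv.Perm (Fin n)) (p : MvPolynomial (Fin n × Fin n) (ZMod 2)),
      Equiv.Perm.sign σ • p = p := by
    intro σ p
    rcases Int.units_eq_one_or (Equiv.Perm.sign σ) with h | h
    · rw [h, one_smul]
    · rw [h, Units.neg_smul, one_smul, CharTwo.neg_eq]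
  have hdet : ∀ a b i i' : Fin n, (Matrix.of fun r c : Fin n =>
      if (c = a → r = i') ∧ (c = b → r = i) then (X (r, c) : MvPolynomial (Fin n × Fin n) (ZMod 2))
      else 0).det = ∑ σ : Equiv.Perm (Fin n),
        (if (σ a = i' ∧ σ b = i) then (1 : ZMod 2) else 0) •
          ∏ c, (X (σ c, c) : MvPolynomial (Fin n × Fin n) (ZMod 2)) := by
    intro a b i i'
    rw [det_pinned_eq]
    refine Finset.sum_congr rfl fun σ _ => ?_
    rw [hsmul, boole_smul]
  -- push everything into one coefficient per permutation
  have hL : (∑ q : Fin n × Fin n × Fin n × Fin n,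
      if q.1 < q.2.1 ∧ q.2.2.1 < q.2.2.2 then
        (Matrix.of fun r c : Fin n =>
          if (c = q.1 → r = q.2.2.2) ∧ (c = q.2.1 → r = q.2.2.1) then
            (X (r, c) : MvPolynomial (Fin n × Fin n) (ZMod 2)) else 0).det
      else 0) =
      ∑ σ : Equiv.Perm (Fin n), (∑ q : Fin n × Fin n × Fin n × Fin n,
        if (q.1 < q.2.1 ∧ q.2.2.1 < q.2.2.2) ∧ (σ q.1 = q.2.2.2 ∧ σ q.2.1 = q.2.2.1) then
          (1 : ZMod 2) else 0) • ∏ c, (X (σ c, c) : MvPolynomial (Fin n × Fin n) (ZMod 2)) := by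
    have step : ∀ q : Fin n × Fin n × Fin n × Fin n,
        (if q.1 < q.2.1 ∧ q.2.2.1 < q.2.2.2 then
          (Matrix.of fun r c : Fin n =>
            if (c = q.1 → r = q.2.2.2) ∧ (c = q.2.1 → r = q.2.2.1) then
              (X (r, c) : MvPolynomial (Fin n × Fin n) (ZMod 2)) else 0).det
        else 0) =
        ∑ σ : Equiv.Perm (Fin n),
          (if (q.1 < q.2.1 ∧ q.2.2.1 < q.2.2.2) ∧ (σ q.1 = q.2.2.2 ∧ σ q.2.1 = q.2.2.1) then
            (1 : ZMod 2) else 0) • ∏ c, (X (σ c, c) : MvPolynomial (Fin n × Fin n) (ZMod 2)) := by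
      intro q
      rw [hdet]
      split_ifs with hq
      · refine Finset.sum_congr rfl fun σ _ => ?_
        simp only [hq, true_and]
      · symm
        refine Finset.sum_eq_zero fun σ _ => ?_
        rw [if_neg (fun h => hq h.1), zero_smul]
    simp_rw [step]
    rw [Finset.sum_comm]
    refine Finset.sum_congr rfl fun σ _ => ?_
    rw [Finset.sum_smul]
  -- the coefficient is the inversion count mod 2
  have hcoef : ∀ σ : Equiv.Perm (Fin n), (∑ q : Fin n × Fin n × Fin n × Fin n,
      if (q.1 < q.2.1 ∧ q.2.2.1 < q.2.2.2) ∧ (σ q.1 = q.2.2.2 ∧ σ q.2.1 = q.2.2.1) then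
        (1 : ZMod 2) else 0) = ((PairingDP.invCountP σ : ℕ) : ZMod 2) := by
    intro σ
    rw [PairingDP.invCountP, Nat.cast_sum, Fintype.sum_prod_type]
    refine Finset.sum_congr rfl fun a _ => ?_
    rw [Nat.cast_sum, Fintype.sum_prod_type]
    refine Finset.sum_congr rfl fun b _ => ?_
    rw [Fintype.sum_prod_type, Nat.cast_ite, Nat.cast_one, Nat.cast_zero]
    exact sum_sum_ite_pin_eq σ a b
  rw [hL, Finset.sum_filter]
  refine Finset.sum_congr rfl fun σ _ => ?_
  rw [hcoef, invCountP_cast_zmod_two, boole_smul]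

/-- **`per_n = det_n + 2 J_n` over `ℤ/4`**, with `J_n` the sum of the pinned determinants over
`a < b`, `i < i'`. -/
theorem perPoly_zmod_four_eq (n : ℕ) :
    perPoly (Fin n) (ZMod 4) = detPoly (Fin n) (ZMod 4) + (2 : ZMod 4) •
      ∑ q : Fin n × Fin n × Fin n × Fin n,
        if q.1 < q.2.1 ∧ q.2.2.1 < q.2.2.2 then
          (Matrix.of fun r c : Fin n =>
            if (c = q.1 → r = q.2.2.2) ∧ (c = q.2.1 → r = q.2.2.1) then
              (X (r, c) : MvPolynomial (Fin n × Fin n) (ZMod 4)) else 0).det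
        else 0 := by
  classical
  set π : ZMod 4 →+* ZMod 2 := ZMod.castHom (show 2 ∣ 4 by norm_num) (ZMod 2) with hπ
  set J₄ : MvPolynomial (Fin n × Fin n) (ZMod 4) := ∑ q : Fin n × Fin n × Fin n × Fin n,
        if q.1 < q.2.1 ∧ q.2.2.1 < q.2.2.2 then
          (Matrix.of fun r c : Fin n =>
            if (c = q.1 → r = q.2.2.2) ∧ (c = q.2.1 → r = q.2.2.1) then
              (X (r, c) : MvPolynomial (Fin n × Fin n) (ZMod 4)) else 0).det
        else 0 with hJ₄
  set O₄ : MvPolynomial (Fin n × Fin n) (ZMod 4) :=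
    ∑ σ ∈ (Finset.univ : Finset (Equiv.Perm (Fin n))).filter (fun σ => Equiv.Perm.sign σ = -1),
      ∏ c : Fin n, (X (σ c, c) : MvPolynomial (Fin n × Fin n) (ZMod 4)) with hO₄
  have hmapJ : MvPolynomial.map π J₄ = ∑ q : Fin n × Fin n × Fin n × Fin n,
      if q.1 < q.2.1 ∧ q.2.2.1 < q.2.2.2 then
        (Matrix.of fun r c : Fin n =>
          if (c = q.1 → r = q.2.2.2) ∧ (c = q.2.1 → r = q.2.2.1) then
            (X (r, c) : MvPolynomial (Fin n × Fin n) (ZMod 2)) else 0).det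
      else 0 := by
    rw [hJ₄, map_sum]
    refine Finset.sum_congr rfl fun q _ => ?_
    rw [apply_ite (MvPolynomial.map π), map_zero, RingHom.map_det, RingHom.mapMatrix_apply]
    congr 2
    ext r c
    simp only [Matrix.map_apply, Matrix.of_apply, apply_ite (MvPolynomial.map π), map_X, map_zero]
  have hmapO : MvPolynomial.map π O₄ =
      ∑ σ ∈ (Finset.univ : Finset (Equiv.Perm (Fin n))).filter (fun σ => Equiv.Perm.sign σ = -1),
        ∏ c : Fin n, (X (σ c, c) : MvPolynomial (Fin n × Fin n) (ZMod 2)) := by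
    simp only [hO₄, map_sum, map_prod, map_X]
  have h2 : (2 : ZMod 4) • O₄ = (2 : ZMod 4) • J₄ := by
    rw [← sub_eq_zero, ← smul_sub]
    refine two_smul_eq_zero_of_map_castHom_eq_zero _ ?_
    rw [map_sub, hmapO, hmapJ, sum_det_pinned_eq_oddPerm, sub_self]
  have hsub := perPoly_sub_detPoly_eq (ZMod 4) n
  rw [← hO₄, h2] at hsub
  rw [← hsub]
  ring

/-- **Item `CeilingModFour` holds**: the permanent family is p-computable over `ℤ/4`. -/
theorem ceilingModFour_proof :
    Summit.ValiantsHypothesis.ValiantsHypothesis.Theses.TwoAdicLadder.CeilingModFour := by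
  unfold Summit.ValiantsHypothesis.ValiantsHypothesis.Theses.TwoAdicLadder.CeilingModFour
  classical
  have hdet : IsPBounded fun n => complexity (detPoly (Fin n) (ZMod 4)) :=
    (isVPFamily_detPoly_of_commRing (ZMod 4)).2
  have hpow : IsPBounded fun n : ℕ => n ^ 4 := ⟨4, fun n => Nat.le_add_right _ _⟩
  -- pointwise: `L(per_n) ≤ L(det_n) + ((n⁴ L(det_n) + n⁴) + 1) + 1`
  have hpt : ∀ n, complexity (perPoly (Fin n) (ZMod 4)) ≤
      complexity (detPoly (Fin n) (ZMod 4)) +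
        ((n ^ 4 * complexity (detPoly (Fin n) (ZMod 4)) + n ^ 4) + 1) + 1 := by
    intro n
    rw [perPoly_zmod_four_eq n]
    refine (complexity_add_le_holds _ _).trans ?_
    refine Nat.add_le_add_right (Nat.add_le_add_left ?_ _) 1
    refine (complexity_smul_le_holds _ _).trans (Nat.add_le_add_right ?_ 1)
    have hcard : (Finset.univ : Finset (Fin n × Fin n × Fin n × Fin n)).card = n ^ 4 := by
      simp only [Finset.card_univ, Fintype.card_prod, Fintype.card_fin]
      ring
    refine (complexity_finset_sum_le _ _).trans ?_
    rw [hcard]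
    refine Nat.add_le_add_right ?_ _
    have hterm : ∀ q ∈ (Finset.univ : Finset (Fin n × Fin n × Fin n × Fin n)),
        complexity (if q.1 < q.2.1 ∧ q.2.2.1 < q.2.2.2 then
          (Matrix.of fun r c : Fin n =>
            if (c = q.1 → r = q.2.2.2) ∧ (c = q.2.1 → r = q.2.2.1) then
              (X (r, c) : MvPolynomial (Fin n × Fin n) (ZMod 4)) else 0).det
          else 0) ≤ complexity (detPoly (Fin n) (ZMod 4)) := by
      intro q _
      split_ifs
      · exact complexity_det_pinned_le _ _ _ _
      · rw [← C_0, complexity_C_holds]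
        exact Nat.zero_le _
    refine (Finset.sum_le_card_nsmul _ _ _ hterm).trans ?_
    rw [hcard, smul_eq_mul]
  exact IsPBounded.mono (IsPBounded.add_holds (IsPBounded.add_holds hdet
    (IsPBounded.add_holds (IsPBounded.add_holds (IsPBounded.mul_holds hpow hdet) hpow)
      (IsPBounded.const 1))) (IsPBounded.const 1)) hpt

end Summit.ValiantsHypothesis.ValiantsHypothesis.Theorems.TwoAdicLadder

end
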